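import Mathlib
import HarnessLib
import Summits.ValiantsHypothesis.ValiantsHypothesis.Theorems.LacunarySymmetroidMatrixDescartesProductPlusOneSixthOrderTower
import Summits.ValiantsHypothesis.ValiantsHypothesis.Theorems.LacunarySymmetroidMatrixDescartesProductPlusOneEighthOrderRowLaws

/-!
# LINE (A) `product_plus_one` (crux `MatrixDescartes`, stmt-ValiantsHypothesis-18050, V1) — W-CB, brick E4♯c (part 1): the ORDER-8 ROW TOWER (`S₇, S₈`) of a
# binomial company and the PER-ROW FACTS under `Λ₄♯ = (θ²−p²)(θ²−s²)(θ²−(p+s)²)(θ²−(3p²+s²))` on the regime `p ≤ s ≤ 2p`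

Continuation of ✓/⧗ `…SixthOrderTower` (rows `S₀…S₆`, `hasDerivAt_tower2..5`) one order up, for pen val-idea-25 g5's repaired order-8 certificate (memo §28.2′,
second-engine check `pub/val-lit/lmr/p7g18-probes/order8sharp.py`):
* `hasDerivAt_tower6` — `θ(r⁶ψ₁ + 126r⁴ψ₁² + 1680r²ψ₁³ + 5040ψ₁⁴) = (r⁶ + 252r⁴ψ₁ + 5040r²ψ₁² + 20160ψ₁³)ψ₂`;
* `hasDerivAt_tower7` — `θ((r⁶ + 252r⁴ψ₁ + 5040r²ψ₁² + 20160ψ₁³)ψ₂) = r⁸ψ₁ + 510r⁶ψ₁² + 17640r⁴ψ₁³ + 151200r²ψ₁⁴ + 362880ψ₁⁵` (closure laws at the point);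
* `eighthOrder_row_value` — `S₈ − e₁S₆ + e₂S₄ − e₃S₂ + e₄S₀ = C₂(r)ψ₁² + C₃(r)ψ₁³ + C₄(r)ψ₁⁴ + 362880ψ₁⁵` at `r ∈ {p, s, p+s}` (linear term dies;
  ✓/⧗ `eighthOrder_iterate_alg`, `eighthOrder_lin_vanish`);
* ★ `eighthOrder_row_facts` — ONE menu row (slow/middle/fast knee with its DISC/RING OFF THE WINDOW = the cubic factor `C₂ + C₃ψ₁ + C₄ψ₁² + 362880ψ₁³ > 0` on the
  window; poles with `0 ≤ f(u)f(v)`) ⇒ a rate `r ∈ {p, s, p+s}` with, on the window, `F ≠ 0`, both closure laws, and the order-8 image `Q⁽⁸⁾_r(ψ₁) > 0`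
  (poles: ✓/⧗ `eighthOrder_pole_slow/mid/fast_pos`; knees: the hypothesis via `eighthOrder_knee_off_iff`).
The cell (no nine roots / at most eight) is part 2 `…EighthOrderCell`.

HONEST FRAMING: calculus + algebra for one W-cell; proves nothing about `WronskianBudgetK3` / `OneChangeFloorK3` / the stubs / 18050 / `MatrixDescartes` / B;
`VP ≠ VNP` is NOT proved.  No definitions, no named facts, no sorry; Mathlib + ✓ lane modules only.
-/

set_option linter.dupNamespace false

namespace Summit.ValiantsHypothesis.ValiantsHypothesis.Theorems.LacunarySymmetroidMatrixDescartes

namespace ProductPlusOne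

open Finset Set Polynomial
open scoped BigOperators Topology Polynomial

/-! ### §1 The order-8 row tower -/

section Row

variable (e₁ e₂ : ℕ) (A B C : ℝ)

/-- `θ(r⁶ψ₁ + 126r⁴ψ₁² + 1680r²ψ₁³ + 5040ψ₁⁴) = (r⁶ + 252r⁴ψ₁ + 5040r²ψ₁² + 20160ψ₁³)ψ₂`. [this file's lemma] -/
theorem hasDerivAt_tower6 (r : ℝ) {x : ℝ} (hx : x ≠ 0) (hF : A - B * x ^ (e₁ + 1) - C * x ^ (e₁ + e₂ + 2) ≠ 0) :
    HasDerivAt (fun t => r ^ 6 * rowPsi1 e₁ e₂ A B C t + 126 * r ^ 4 * rowPsi1 e₁ e₂ A B C t ^ 2 + 1680 * r ^ 2 * rowPsi1 e₁ e₂ A B C t ^ 3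
        + 5040 * rowPsi1 e₁ e₂ A B C t ^ 4)
      (((r ^ 6 + 252 * r ^ 4 * rowPsi1 e₁ e₂ A B C x + 5040 * r ^ 2 * rowPsi1 e₁ e₂ A B C x ^ 2 + 20160 * rowPsi1 e₁ e₂ A B C x ^ 3)
        * rowPsi2 e₁ e₂ A B C x) / x) x := by
  have h1 := hasDerivAt_rowPsi1 e₁ e₂ A B C hx hF
  have h := (((h1.const_mul (r ^ 6)).add ((h1.pow 2).const_mul (126 * r ^ 4))).add ((h1.pow 3).const_mul (1680 * r ^ 2))).add
    ((h1.pow 4).const_mul 5040)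
  refine h.congr_deriv ?_
  simp only [Nat.cast_ofNat]
  field_simp
  ring

/-- `θ((r⁶ + 252r⁴ψ₁ + 5040r²ψ₁² + 20160ψ₁³)ψ₂) = r⁸ψ₁ + 510r⁶ψ₁² + 17640r⁴ψ₁³ + 151200r²ψ₁⁴ + 362880ψ₁⁵` given the closure laws at `x`.
[this file's lemma] -/
theorem hasDerivAt_tower7 (r : ℝ) {x : ℝ} (hx : x ≠ 0) (hF : A - B * x ^ (e₁ + 1) - C * x ^ (e₁ + e₂ + 2) ≠ 0)
    (h2 : rowPsi2 e₁ e₂ A B C x ^ 2 = r ^ 2 * rowPsi1 e₁ e₂ A B C x ^ 2 + 4 * rowPsi1 e₁ e₂ A B C x ^ 3)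
    (h3 : rowPsi3 e₁ e₂ A B C x = r ^ 2 * rowPsi1 e₁ e₂ A B C x + 6 * rowPsi1 e₁ e₂ A B C x ^ 2) :
    HasDerivAt (fun t => (r ^ 6 + 252 * r ^ 4 * rowPsi1 e₁ e₂ A B C t + 5040 * r ^ 2 * rowPsi1 e₁ e₂ A B C t ^ 2 + 20160 * rowPsi1 e₁ e₂ A B C t ^ 3)
        * rowPsi2 e₁ e₂ A B C t)
      ((r ^ 8 * rowPsi1 e₁ e₂ A B C x + 510 * r ^ 6 * rowPsi1 e₁ e₂ A B C x ^ 2 + 17640 * r ^ 4 * rowPsi1 e₁ e₂ A B C x ^ 3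
        + 151200 * r ^ 2 * rowPsi1 e₁ e₂ A B C x ^ 4 + 362880 * rowPsi1 e₁ e₂ A B C x ^ 5) / x) x := by
  have h1 := hasDerivAt_rowPsi1 e₁ e₂ A B C hx hF
  have h2' := hasDerivAt_rowPsi2 e₁ e₂ A B C hx hF
  have hpoly : HasDerivAt (fun t => r ^ 6 + 252 * r ^ 4 * rowPsi1 e₁ e₂ A B C t + 5040 * r ^ 2 * rowPsi1 e₁ e₂ A B C t ^ 2
        + 20160 * rowPsi1 e₁ e₂ A B C t ^ 3)
      (252 * r ^ 4 * (rowPsi2 e₁ e₂ A B C x / x) + 5040 * r ^ 2 * (2 * rowPsi1 e₁ e₂ A B C x ^ 1 * (rowPsi2 e₁ e₂ A B C x / x))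
        + 20160 * (3 * rowPsi1 e₁ e₂ A B C x ^ 2 * (rowPsi2 e₁ e₂ A B C x / x))) x := by
    have h := (((h1.const_mul (252 * r ^ 4)).const_add (r ^ 6)).add ((h1.pow 2).const_mul (5040 * r ^ 2))).add ((h1.pow 3).const_mul 20160)
    refine h.congr_deriv ?_
    simp only [Nat.cast_ofNat]
  have h := hpoly.mul h2'
  refine h.congr_deriv ?_
  have hnum : (252 * r ^ 4 + 10080 * r ^ 2 * rowPsi1 e₁ e₂ A B C x + 60480 * rowPsi1 e₁ e₂ A B C x ^ 2) * rowPsi2 e₁ e₂ A B C x ^ 2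
      + (r ^ 6 + 252 * r ^ 4 * rowPsi1 e₁ e₂ A B C x + 5040 * r ^ 2 * rowPsi1 e₁ e₂ A B C x ^ 2 + 20160 * rowPsi1 e₁ e₂ A B C x ^ 3)
          * rowPsi3 e₁ e₂ A B C x
      = r ^ 8 * rowPsi1 e₁ e₂ A B C x + 510 * r ^ 6 * rowPsi1 e₁ e₂ A B C x ^ 2 + 17640 * r ^ 4 * rowPsi1 e₁ e₂ A B C x ^ 3
        + 151200 * r ^ 2 * rowPsi1 e₁ e₂ A B C x ^ 4 + 362880 * rowPsi1 e₁ e₂ A B C x ^ 5 := by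
    linear_combination (252 * r ^ 4 + 10080 * r ^ 2 * rowPsi1 e₁ e₂ A B C x + 60480 * rowPsi1 e₁ e₂ A B C x ^ 2) * h2
      + (r ^ 6 + 252 * r ^ 4 * rowPsi1 e₁ e₂ A B C x + 5040 * r ^ 2 * rowPsi1 e₁ e₂ A B C x ^ 2 + 20160 * rowPsi1 e₁ e₂ A B C x ^ 3) * h3
  rw [← hnum]
  field_simp
  ring

end Row

/-! ### §2 Per-row value and facts under `Λ₄♯` -/

/-- The order-8 row value at a rate `r ∈ {p, s, p+s}`: `S₈ − e₁S₆ + e₂S₄ − e₃S₂ + e₄S₀ = C₂ψ² + C₃ψ³ + C₄ψ⁴ + 362880ψ⁵` with the generic coefficients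
`C₂ = 510r⁶ − 126e₁r⁴ + 30e₂r² − 6e₃`, `C₃ = 17640r⁴ − 1680e₁r² + 120e₂`, `C₄ = 151200r² − 5040e₁` (roots `p², s², (p+s)², 3p²+s²`). [this file's lemma] -/
theorem eighthOrder_row_value (p s r ψ : ℝ) (hr : r = p ∨ r = s ∨ r = p + s) :
    (r ^ 8 * ψ + 510 * r ^ 6 * ψ ^ 2 + 17640 * r ^ 4 * ψ ^ 3 + 151200 * r ^ 2 * ψ ^ 4 + 362880 * ψ ^ 5)
      - (p ^ 2 + s ^ 2 + (p + s) ^ 2 + (3 * p ^ 2 + s ^ 2)) * (r ^ 6 * ψ + 126 * r ^ 4 * ψ ^ 2 + 1680 * r ^ 2 * ψ ^ 3 + 5040 * ψ ^ 4)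
      + (p ^ 2 * s ^ 2 + p ^ 2 * (p + s) ^ 2 + p ^ 2 * (3 * p ^ 2 + s ^ 2) + s ^ 2 * (p + s) ^ 2 + s ^ 2 * (3 * p ^ 2 + s ^ 2)
          + (p + s) ^ 2 * (3 * p ^ 2 + s ^ 2)) * (r ^ 4 * ψ + 30 * r ^ 2 * ψ ^ 2 + 120 * ψ ^ 3)
      - (p ^ 2 * s ^ 2 * (p + s) ^ 2 + p ^ 2 * s ^ 2 * (3 * p ^ 2 + s ^ 2) + p ^ 2 * (p + s) ^ 2 * (3 * p ^ 2 + s ^ 2)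
          + s ^ 2 * (p + s) ^ 2 * (3 * p ^ 2 + s ^ 2)) * (r ^ 2 * ψ + 6 * ψ ^ 2)
      + p ^ 2 * s ^ 2 * (p + s) ^ 2 * (3 * p ^ 2 + s ^ 2) * ψ
    = (510 * r ^ 6 - 126 * (p ^ 2 + s ^ 2 + (p + s) ^ 2 + (3 * p ^ 2 + s ^ 2)) * r ^ 4
          + 30 * (p ^ 2 * s ^ 2 + p ^ 2 * (p + s) ^ 2 + p ^ 2 * (3 * p ^ 2 + s ^ 2) + s ^ 2 * (p + s) ^ 2 + s ^ 2 * (3 * p ^ 2 + s ^ 2)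
              + (p + s) ^ 2 * (3 * p ^ 2 + s ^ 2)) * r ^ 2
          - 6 * (p ^ 2 * s ^ 2 * (p + s) ^ 2 + p ^ 2 * s ^ 2 * (3 * p ^ 2 + s ^ 2) + p ^ 2 * (p + s) ^ 2 * (3 * p ^ 2 + s ^ 2)
              + s ^ 2 * (p + s) ^ 2 * (3 * p ^ 2 + s ^ 2))) * ψ ^ 2
      + (17640 * r ^ 4 - 1680 * (p ^ 2 + s ^ 2 + (p + s) ^ 2 + (3 * p ^ 2 + s ^ 2)) * r ^ 2
          + 120 * (p ^ 2 * s ^ 2 + p ^ 2 * (p + s) ^ 2 + p ^ 2 * (3 * p ^ 2 + s ^ 2) + s ^ 2 * (p + s) ^ 2 + s ^ 2 * (3 * p ^ 2 + s ^ 2)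
              + (p + s) ^ 2 * (3 * p ^ 2 + s ^ 2))) * ψ ^ 3
      + (151200 * r ^ 2 - 5040 * (p ^ 2 + s ^ 2 + (p + s) ^ 2 + (3 * p ^ 2 + s ^ 2))) * ψ ^ 4 + 362880 * ψ ^ 5 := by
  have hlin := eighthOrder_lin_vanish p s r hr
  have key : (r ^ 8 - (p ^ 2 + s ^ 2 + (p + s) ^ 2 + (3 * p ^ 2 + s ^ 2)) * r ^ 6
      + (p ^ 2 * s ^ 2 + p ^ 2 * (p + s) ^ 2 + p ^ 2 * (3 * p ^ 2 + s ^ 2) + s ^ 2 * (p + s) ^ 2 + s ^ 2 * (3 * p ^ 2 + s ^ 2)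
          + (p + s) ^ 2 * (3 * p ^ 2 + s ^ 2)) * r ^ 4
      - (p ^ 2 * s ^ 2 * (p + s) ^ 2 + p ^ 2 * s ^ 2 * (3 * p ^ 2 + s ^ 2) + p ^ 2 * (p + s) ^ 2 * (3 * p ^ 2 + s ^ 2)
          + s ^ 2 * (p + s) ^ 2 * (3 * p ^ 2 + s ^ 2)) * r ^ 2
      + p ^ 2 * s ^ 2 * (p + s) ^ 2 * (3 * p ^ 2 + s ^ 2))
      = (r ^ 2 - p ^ 2) * (r ^ 2 - s ^ 2) * (r ^ 2 - (p + s) ^ 2) * (r ^ 2 - (3 * p ^ 2 + s ^ 2)) := by ring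
  linear_combination ψ * key + ψ * hlin

/-- The order-8 value of a binomial company, summed: `S₈ − e₁S₆ + e₂S₄ − e₃S₂ + e₄S₀ = Σ_j Q⁽⁸⁾_{r_j}(ψ_j)` (rates `r_j ∈ {p, s, p+s}`; rows written
as in the tower statements). [this file's lemma] -/
theorem eighthOrder_sum_value {m : ℕ} (p s : ℝ) (r ψ : Fin m → ℝ) (hr : ∀ j, r j = p ∨ r j = s ∨ r j = p + s) :
   (∑ j, (r j ^ 8 * ψ j + 510 * r j ^ 6 * ψ j ^ 2 + 17640 * r j ^ 4 * ψ j ^ 3 + 151200 * r j ^ 2 * ψ j ^ 4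
        + 362880 * ψ j ^ 5))
      - (p ^ 2 + s ^ 2 + (p + s) ^ 2 + (3 * p ^ 2 + s ^ 2)) * (∑ j, (r j ^ 6 * ψ j + 126 * r j ^ 4 * ψ j ^ 2 + 1680 * r j ^ 2 * ψ j ^ 3 + 5040 * ψ j ^ 4))
      + (p ^ 2 * s ^ 2 + p ^ 2 * (p + s) ^ 2 + p ^ 2 * (3 * p ^ 2 + s ^ 2) + s ^ 2 * (p + s) ^ 2 + s ^ 2 * (3 * p ^ 2 + s ^ 2)
              + (p + s) ^ 2 * (3 * p ^ 2 + s ^ 2)) * (∑ j, (r j ^ 4 * ψ j + 30 * r j ^ 2 * ψ j ^ 2 + 120 * ψ j ^ 3))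
      - (p ^ 2 * s ^ 2 * (p + s) ^ 2 + p ^ 2 * s ^ 2 * (3 * p ^ 2 + s ^ 2) + p ^ 2 * (p + s) ^ 2 * (3 * p ^ 2 + s ^ 2)
              + s ^ 2 * (p + s) ^ 2 * (3 * p ^ 2 + s ^ 2)) * (∑ j, (r j ^ 2 * ψ j + 6 * ψ j ^ 2))
      + (p ^ 2 * s ^ 2 * (p + s) ^ 2 * (3 * p ^ 2 + s ^ 2)) * (∑ j, ψ j)
      = ∑ j, ((510 * r j ^ 6 - 126 * (p ^ 2 + s ^ 2 + (p + s) ^ 2 + (3 * p ^ 2 + s ^ 2)) * r j ^ 4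
          + 30 * (p ^ 2 * s ^ 2 + p ^ 2 * (p + s) ^ 2 + p ^ 2 * (3 * p ^ 2 + s ^ 2) + s ^ 2 * (p + s) ^ 2 + s ^ 2 * (3 * p ^ 2 + s ^ 2)
              + (p + s) ^ 2 * (3 * p ^ 2 + s ^ 2)) * r j ^ 2
          - 6 * (p ^ 2 * s ^ 2 * (p + s) ^ 2 + p ^ 2 * s ^ 2 * (3 * p ^ 2 + s ^ 2) + p ^ 2 * (p + s) ^ 2 * (3 * p ^ 2 + s ^ 2)
              + s ^ 2 * (p + s) ^ 2 * (3 * p ^ 2 + s ^ 2))) * ψ j ^ 2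
      + (17640 * r j ^ 4 - 1680 * (p ^ 2 + s ^ 2 + (p + s) ^ 2 + (3 * p ^ 2 + s ^ 2)) * r j ^ 2
          + 120 * (p ^ 2 * s ^ 2 + p ^ 2 * (p + s) ^ 2 + p ^ 2 * (3 * p ^ 2 + s ^ 2) + s ^ 2 * (p + s) ^ 2 + s ^ 2 * (3 * p ^ 2 + s ^ 2)
              + (p + s) ^ 2 * (3 * p ^ 2 + s ^ 2))) * ψ j ^ 3
      + (151200 * r j ^ 2 - 5040 * (p ^ 2 + s ^ 2 + (p + s) ^ 2 + (3 * p ^ 2 + s ^ 2))) * ψ j ^ 4 + 362880 * ψ j ^ 5) := by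
  rw [Finset.mul_sum, Finset.mul_sum, Finset.mul_sum, Finset.mul_sum, ← Finset.sum_sub_distrib, ← Finset.sum_add_distrib,
    ← Finset.sum_sub_distrib, ← Finset.sum_add_distrib]
  exact Finset.sum_congr rfl (fun j _ => eighthOrder_row_value p s (r j) (ψ j) (hr j))

/-- ★ **Per-row facts under `Λ₄♯`** (one binomial row `b`, regime `p ≤ s ≤ 2p`): a rate `r ∈ {p, s, p+s}` such that at every point of the window the
normal form is nonzero, both closure laws hold, and the order-8 image `Q⁽⁸⁾_r(ψ₁) > 0` (poles: E4♯a sign theorems; knees: the disc/ring hypothesis).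
[this file's lemma] -/
theorem eighthOrder_row_facts (e₁ e₂ : ℕ) (hps : e₁ + 1 ≤ e₂ + 1) (hs2 : e₂ + 1 ≤ 2 * (e₁ + 1)) (b : Fin 3 → ℝ) {u v : ℝ} (hu : 0 < u)
    (hrow :
      (b 2 = 0 ∧ 0 < b 0 * b 1 ∧ ∀ x ∈ Ioo u v,
          0 < 6 * ((((e₂ : ℝ) + 1) - ((e₁ : ℝ) + 1)) ^ 2 * (2 * ((e₁ : ℝ) + 1) - ((e₂ : ℝ) + 1)) * (((e₁ : ℝ) + 1) + ((e₂ : ℝ) + 1)) * (2 * ((e₁ : ℝ) + 1)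
                  + ((e₂ : ℝ) + 1)) * (3 * ((e₁ : ℝ) + 1) + ((e₂ : ℝ) + 1))) + 120 * ((2 * ((e₁ : ℝ) + 1) - ((e₂ : ℝ) + 1)) ^ 2 * (3 * ((e₁ : ℝ) + 1)
                  + ((e₂ : ℝ) + 1)) * (7 * ((e₁ : ℝ) + 1) + 3 * ((e₂ : ℝ) + 1))) * rowPsi1 e₁ e₂ (b 0) (-(b 1)) (-(b 2)) x
            + 2520 * (50 * ((e₁ : ℝ) + 1) ^ 2 - 4 * ((e₁ : ℝ) + 1) * ((e₂ : ℝ) + 1) - 6 * ((e₂ : ℝ) + 1) ^ 2) * rowPsi1 e₁ e₂ (b 0) (-(b 1)) (-(b 2)) x ^ 2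
                    + 362880 * rowPsi1 e₁ e₂ (b 0) (-(b 1)) (-(b 2)) x ^ 3) ∨
      (b 2 = 0 ∧ b 0 * b 1 < 0 ∧ 0 ≤ (b 0 + b 1 * u ^ (e₁ + 1) + b 2 * u ^ (e₁ + e₂ + 2)) * (b 0 + b 1 * v ^ (e₁ + 1) + b 2 * v ^ (e₁ + e₂ + 2))) ∨
      (b 0 = 0 ∧ 0 < b 1 * b 2 ∧ ∀ x ∈ Ioo u v,
          0 < 18 * ((((e₂ : ℝ) + 1) - ((e₁ : ℝ) + 1)) ^ 2 * (((e₁ : ℝ) + 1) + ((e₂ : ℝ) + 1)) * (2 * ((e₂ : ℝ) + 1) - ((e₁ : ℝ) + 1)) * (2 * ((e₂ : ℝ) + 1)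
                  + ((e₁ : ℝ) + 1)) * (3 * ((e₂ : ℝ) + 1) + ((e₁ : ℝ) + 1)))
            + 120 * (7 * ((e₁ : ℝ) + 1) ^ 4 + 8 * ((e₁ : ℝ) + 1) ^ 3 * ((e₂ : ℝ) + 1) - 59 * ((e₁ : ℝ) + 1) ^ 2 * ((e₂ : ℝ) + 1) ^ 2 - 24 * ((e₁ : ℝ)
                    + 1) * ((e₂ : ℝ) + 1) ^ 3 + 108 * ((e₂ : ℝ) + 1) ^ 4) * rowPsi1 e₁ e₂ (b 0) (-(b 1)) (-(b 2)) x
            + 2520 * (54 * ((e₂ : ℝ) + 1) ^ 2 - 4 * ((e₁ : ℝ) + 1) * ((e₂ : ℝ) + 1) - 10 * ((e₁ : ℝ)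
                    + 1) ^ 2) * rowPsi1 e₁ e₂ (b 0) (-(b 1)) (-(b 2)) x ^ 2 + 362880 * rowPsi1 e₁ e₂ (b 0) (-(b 1)) (-(b 2)) x ^ 3) ∨
      (b 0 = 0 ∧ b 1 * b 2 < 0 ∧ 0 ≤ (b 0 + b 1 * u ^ (e₁ + 1) + b 2 * u ^ (e₁ + e₂ + 2)) * (b 0 + b 1 * v ^ (e₁ + 1) + b 2 * v ^ (e₁ + e₂ + 2))) ∨
      (b 1 = 0 ∧ 0 < b 0 * b 2 ∧ ∀ x ∈ Ioo u v,
          0 < (72 * ((e₁ : ℝ) + 1) ^ 6 + 912 * ((e₁ : ℝ) + 1) ^ 5 * ((e₂ : ℝ) + 1) + 3438 * ((e₁ : ℝ) + 1) ^ 4 * ((e₂ : ℝ) + 1) ^ 2 + 5616 * ((e₁ : ℝ)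
                  + 1) ^ 3 * ((e₂ : ℝ) + 1) ^ 3 + 4362 * ((e₁ : ℝ) + 1) ^ 2 * ((e₂ : ℝ) + 1) ^ 4 + 1584 * ((e₁ : ℝ) + 1) * ((e₂ : ℝ) + 1) ^ 5
                  + 216 * ((e₂ : ℝ) + 1) ^ 6)
            + (10080 * ((e₁ : ℝ) + 1) ^ 4 + 51360 * ((e₁ : ℝ) + 1) ^ 3 * ((e₂ : ℝ) + 1) + 87000 * ((e₁ : ℝ) + 1) ^ 2 * ((e₂ : ℝ) + 1) ^ 2
                    + 57600 * ((e₁ : ℝ) + 1) * ((e₂ : ℝ) + 1) ^ 3 + 12960 * ((e₂ : ℝ) + 1) ^ 4) * rowPsi1 e₁ e₂ (b 0) (-(b 1)) (-(b 2)) x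
            + (126000 * ((e₁ : ℝ) + 1) ^ 2 + 292320 * ((e₁ : ℝ) + 1) * ((e₂ : ℝ) + 1) + 136080 * ((e₂ : ℝ)
                    + 1) ^ 2) * rowPsi1 e₁ e₂ (b 0) (-(b 1)) (-(b 2)) x ^ 2 + 362880 * rowPsi1 e₁ e₂ (b 0) (-(b 1)) (-(b 2)) x ^ 3) ∨
      (b 1 = 0 ∧ b 0 * b 2 < 0 ∧ 0 ≤ (b 0 + b 1 * u ^ (e₁ + 1) + b 2 * u ^ (e₁ + e₂ + 2)) * (b 0 + b 1 * v ^ (e₁ + 1) + b 2 * v ^ (e₁ + e₂ + 2)))) :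
    ∃ r : ℝ, (r = ((e₁ : ℝ) + 1) ∨ r = ((e₂ : ℝ) + 1) ∨ r = ((e₁ : ℝ) + 1) + ((e₂ : ℝ) + 1)) ∧ ∀ x ∈ Ioo u v,
      b 0 - (-(b 1)) * x ^ (e₁ + 1) - (-(b 2)) * x ^ (e₁ + e₂ + 2) ≠ 0 ∧
      rowPsi3 e₁ e₂ (b 0) (-(b 1)) (-(b 2)) x
        = r ^ 2 * rowPsi1 e₁ e₂ (b 0) (-(b 1)) (-(b 2)) x + 6 * rowPsi1 e₁ e₂ (b 0) (-(b 1)) (-(b 2)) x ^ 2 ∧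
      rowPsi2 e₁ e₂ (b 0) (-(b 1)) (-(b 2)) x ^ 2
        = r ^ 2 * rowPsi1 e₁ e₂ (b 0) (-(b 1)) (-(b 2)) x ^ 2 + 4 * rowPsi1 e₁ e₂ (b 0) (-(b 1)) (-(b 2)) x ^ 3 ∧
      0 < (510 * r ^ 6 - 126 * (((e₁ : ℝ) + 1) ^ 2 + ((e₂ : ℝ) + 1) ^ 2 + (((e₁ : ℝ) + 1) + ((e₂ : ℝ) + 1)) ^ 2 + (3 * ((e₁ : ℝ) + 1) ^ 2 + ((e₂ : ℝ)
              + 1) ^ 2)) * r ^ 4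
          + 30 * (((e₁ : ℝ) + 1) ^ 2 * ((e₂ : ℝ) + 1) ^ 2 + ((e₁ : ℝ) + 1) ^ 2 * (((e₁ : ℝ) + 1) + ((e₂ : ℝ) + 1)) ^ 2 + ((e₁ : ℝ)
                  + 1) ^ 2 * (3 * ((e₁ : ℝ) + 1) ^ 2 + ((e₂ : ℝ) + 1) ^ 2) + ((e₂ : ℝ) + 1) ^ 2 * (((e₁ : ℝ) + 1) + ((e₂ : ℝ) + 1)) ^ 2 + ((e₂ : ℝ)
                  + 1) ^ 2 * (3 * ((e₁ : ℝ) + 1) ^ 2 + ((e₂ : ℝ) + 1) ^ 2)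
              + (((e₁ : ℝ) + 1) + ((e₂ : ℝ) + 1)) ^ 2 * (3 * ((e₁ : ℝ) + 1) ^ 2 + ((e₂ : ℝ) + 1) ^ 2)) * r ^ 2
          - 6 * (((e₁ : ℝ) + 1) ^ 2 * ((e₂ : ℝ) + 1) ^ 2 * (((e₁ : ℝ) + 1) + ((e₂ : ℝ) + 1)) ^ 2 + ((e₁ : ℝ) + 1) ^ 2 * ((e₂ : ℝ) + 1) ^ 2 * (3 * ((e₁ : ℝ)
                  + 1) ^ 2 + ((e₂ : ℝ) + 1) ^ 2) + ((e₁ : ℝ) + 1) ^ 2 * (((e₁ : ℝ) + 1) + ((e₂ : ℝ) + 1)) ^ 2 * (3 * ((e₁ : ℝ) + 1) ^ 2 + ((e₂ : ℝ) + 1) ^ 2)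
              + ((e₂ : ℝ) + 1) ^ 2 * (((e₁ : ℝ) + 1) + ((e₂ : ℝ) + 1)) ^ 2 * (3 * ((e₁ : ℝ) + 1) ^ 2 + ((e₂ : ℝ)
                      + 1) ^ 2))) * rowPsi1 e₁ e₂ (b 0) (-(b 1)) (-(b 2)) x ^ 2
      + (17640 * r ^ 4 - 1680 * (((e₁ : ℝ) + 1) ^ 2 + ((e₂ : ℝ) + 1) ^ 2 + (((e₁ : ℝ) + 1) + ((e₂ : ℝ) + 1)) ^ 2 + (3 * ((e₁ : ℝ) + 1) ^ 2 + ((e₂ : ℝ)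
              + 1) ^ 2)) * r ^ 2
          + 120 * (((e₁ : ℝ) + 1) ^ 2 * ((e₂ : ℝ) + 1) ^ 2 + ((e₁ : ℝ) + 1) ^ 2 * (((e₁ : ℝ) + 1) + ((e₂ : ℝ) + 1)) ^ 2 + ((e₁ : ℝ)
                  + 1) ^ 2 * (3 * ((e₁ : ℝ) + 1) ^ 2 + ((e₂ : ℝ) + 1) ^ 2) + ((e₂ : ℝ) + 1) ^ 2 * (((e₁ : ℝ) + 1) + ((e₂ : ℝ) + 1)) ^ 2 + ((e₂ : ℝ)
                  + 1) ^ 2 * (3 * ((e₁ : ℝ) + 1) ^ 2 + ((e₂ : ℝ) + 1) ^ 2)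
              + (((e₁ : ℝ) + 1) + ((e₂ : ℝ) + 1)) ^ 2 * (3 * ((e₁ : ℝ) + 1) ^ 2 + ((e₂ : ℝ) + 1) ^ 2))) * rowPsi1 e₁ e₂ (b 0) (-(b 1)) (-(b 2)) x ^ 3
      + (151200 * r ^ 2 - 5040 * (((e₁ : ℝ) + 1) ^ 2 + ((e₂ : ℝ) + 1) ^ 2 + (((e₁ : ℝ) + 1) + ((e₂ : ℝ) + 1)) ^ 2 + (3 * ((e₁ : ℝ) + 1) ^ 2 + ((e₂ : ℝ)
              + 1) ^ 2))) * rowPsi1 e₁ e₂ (b 0) (-(b 1)) (-(b 2)) x ^ 4 + 362880 * rowPsi1 e₁ e₂ (b 0) (-(b 1)) (-(b 2)) x ^ 5 := by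
  set p : ℝ := (e₁ : ℝ) + 1 with hp
  set s : ℝ := (e₂ : ℝ) + 1 with hs
  have hp0 : 0 < p := by rw [hp]; positivity
  have hs0 : 0 < s := by rw [hs]; positivity
  have hps' : p ≤ s := by
    rw [hp, hs]
    have : ((e₁ + 1 : ℕ) : ℝ) ≤ ((e₂ + 1 : ℕ) : ℝ) := by exact_mod_cast hps
    push_cast at this; linarith
  have hs2' : s ≤ 2 * p := by
    rw [hp, hs]
    have : ((e₂ + 1 : ℕ) : ℝ) ≤ ((2 * (e₁ + 1) : ℕ) : ℝ) := by exact_mod_cast hs2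
    push_cast at this; linarith
  have huv_pos : ∀ x ∈ Ioo u v, 0 < x := fun x hx => hu.trans hx.1
  rcases hrow with ⟨h2, hsgn, hring⟩ | ⟨h2, hsgn, hend⟩ | ⟨h0, hsgn, hring⟩ | ⟨h0, hsgn, hend⟩ | ⟨h1, hsgn, hring⟩ | ⟨h1, hsgn, hend⟩
  · -- (K01) slow knee, rate p, disc/ring off the window
    refine ⟨p, Or.inl rfl, fun x hx => ?_⟩
    have hx0 := huv_pos x hx
    have hn2 : -(b 2) = 0 := by rw [h2, neg_zero]
    have hAB : b 0 * (-(b 1)) < 0 := by nlinarith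
    have hψ := pair01_knee_rowPsi1_neg e₁ e₂ (b 0) (-(b 1)) hx0 hAB
    have hF : b 0 - (-(b 1)) * x ^ (e₁ + 1) ≠ 0 := by
      intro h
      have hA : b 0 = -(b 1) * x ^ (e₁ + 1) := by linarith
      rw [hA] at hAB
      nlinarith [sq_nonneg (b 1), pow_pos hx0 (e₁ + 1)]
    have hq := hring x hx
    rw [hn2] at hq ⊢
    refine ⟨by rwa [zero_mul, sub_zero], ?_, ?_, ?_⟩
    · have h := pair01_rowPsi3_law e₁ e₂ (b 0) (-(b 1)) x
      rw [hp]; linarith [h]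
    · rw [hp]; exact pair01_rowPsi2_sq e₁ e₂ (b 0) (-(b 1)) x
    · rw [eighthOrder_c2_slow p s, eighthOrder_c3_slow p s, eighthOrder_c4_slow p s]
      have hψne : rowPsi1 e₁ e₂ (b 0) (-(b 1)) 0 x ≠ 0 := hψ.ne
      rw [hp, hs] at hq ⊢
      exact (eighthOrder_knee_off_iff _ _ _ _ hψne).2 hq
  · -- (P01) slow pole, rate p
    refine ⟨p, Or.inl rfl, fun x hx => ?_⟩
    have hx0 := huv_pos x hx
    have hn2 : -(b 2) = 0 := by rw [h2, neg_zero]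
    have hb1 : b 1 ≠ 0 := by rintro h; rw [h, mul_zero] at hsgn; exact lt_irrefl _ hsgn
    have hend' : 0 ≤ (b 0 + b 1 * u ^ (e₁ + 1)) * (b 0 + b 1 * v ^ (e₁ + 1)) := by
      rw [h2] at hend; simpa using hend
    have hne : b 0 + b 1 * x ^ (e₁ + 1) ≠ 0 :=
      binomial_ne_zero_of_endpoints (b 0) (b 1) (Nat.succ_ne_zero e₁) hu hx hend' hb1
    have hF : b 0 - (-(b 1)) * x ^ (e₁ + 1) ≠ 0 := by
      have : b 0 - (-(b 1)) * x ^ (e₁ + 1) = b 0 + b 1 * x ^ (e₁ + 1) := by ring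
      rwa [this]
    have hψ : 0 < rowPsi1 e₁ e₂ (b 0) (-(b 1)) 0 x := pair01_pole_rowPsi1_pos e₁ e₂ (b 0) (-(b 1)) hx0 (by nlinarith) hF
    rw [hn2]
    refine ⟨by rwa [zero_mul, sub_zero], ?_, ?_, ?_⟩
    · have h := pair01_rowPsi3_law e₁ e₂ (b 0) (-(b 1)) x
      rw [hp]; linarith [h]
    · rw [hp]; exact pair01_rowPsi2_sq e₁ e₂ (b 0) (-(b 1)) x
    · rw [eighthOrder_c2_slow p s, eighthOrder_c3_slow p s, eighthOrder_c4_slow p s]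
      exact eighthOrder_pole_slow_pos hp0 hps' hs2' hψ
  · -- (K12) middle knee, rate s
    refine ⟨s, Or.inr (Or.inl rfl), fun x hx => ?_⟩
    have hx0 := huv_pos x hx
    have hBC : 0 < (-(b 1)) * (-(b 2)) := by nlinarith
    have hψ := pair12_knee_rowPsi1_neg e₁ e₂ (-(b 1)) (-(b 2)) hx0 hBC
    have hsame : b 1 + b 2 * x ^ (e₂ + 1) ≠ 0 := by
      intro h
      have : b 1 * (b 1 + b 2 * x ^ (e₂ + 1)) = 0 := by rw [h, mul_zero]
      nlinarith [mul_self_nonneg (b 1), mul_pos hsgn (pow_pos hx0 (e₂ + 1))]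
    have hF : (0 : ℝ) - (-(b 1)) * x ^ (e₁ + 1) - (-(b 2)) * x ^ (e₁ + e₂ + 2) ≠ 0 := by
      have : (0 : ℝ) - (-(b 1)) * x ^ (e₁ + 1) - (-(b 2)) * x ^ (e₁ + e₂ + 2) = x ^ (e₁ + 1) * (b 1 + b 2 * x ^ (e₂ + 1)) := by ring
      rw [this]; exact mul_ne_zero (pow_ne_zero _ hx0.ne') hsame
    have hq := hring x hx
    rw [h0] at hq ⊢
    refine ⟨hF, ?_, ?_, ?_⟩
    · have h := pair12_rowPsi3_law e₁ e₂ (-(b 1)) (-(b 2)) hF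
      rw [hs]; linarith [h]
    · rw [hs]; exact pair12_rowPsi2_sq e₁ e₂ (-(b 1)) (-(b 2)) hF
    · rw [eighthOrder_c2_mid p s, eighthOrder_c3_mid p s, eighthOrder_c4_mid p s]
      have hψne : rowPsi1 e₁ e₂ 0 (-(b 1)) (-(b 2)) x ≠ 0 := hψ.ne
      rw [hp, hs] at hq ⊢
      exact (eighthOrder_knee_off_iff _ _ _ _ hψne).2 hq
  · -- (P12) pole, rate s
    refine ⟨s, Or.inr (Or.inl rfl), fun x hx => ?_⟩
    have hx0 := huv_pos x hx
    have hv : 0 < v := hu.trans (hx.1.trans hx.2)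
    have hb2 : b 2 ≠ 0 := by rintro h; rw [h, mul_zero] at hsgn; exact lt_irrefl _ hsgn
    have hend' : 0 ≤ (b 1 + b 2 * u ^ (e₂ + 1)) * (b 1 + b 2 * v ^ (e₂ + 1)) := by
      rw [h0] at hend
      have hfac : (0 + b 1 * u ^ (e₁ + 1) + b 2 * u ^ (e₁ + e₂ + 2)) * (0 + b 1 * v ^ (e₁ + 1) + b 2 * v ^ (e₁ + e₂ + 2))
          = (u ^ (e₁ + 1) * v ^ (e₁ + 1)) * ((b 1 + b 2 * u ^ (e₂ + 1)) * (b 1 + b 2 * v ^ (e₂ + 1))) := by ring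
      rw [hfac] at hend
      exact (mul_nonneg_iff_of_pos_left (mul_pos (pow_pos hu _) (pow_pos hv _))).1 hend
    have hne : b 1 + b 2 * x ^ (e₂ + 1) ≠ 0 :=
      binomial_ne_zero_of_endpoints (b 1) (b 2) (Nat.succ_ne_zero _) hu hx hend' hb2
    have hF : (0 : ℝ) - (-(b 1)) * x ^ (e₁ + 1) - (-(b 2)) * x ^ (e₁ + e₂ + 2) ≠ 0 := by
      have : (0 : ℝ) - (-(b 1)) * x ^ (e₁ + 1) - (-(b 2)) * x ^ (e₁ + e₂ + 2) = x ^ (e₁ + 1) * (b 1 + b 2 * x ^ (e₂ + 1)) := by ring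
      rw [this]; exact mul_ne_zero (pow_ne_zero _ hx0.ne') hne
    have hψ : 0 < rowPsi1 e₁ e₂ 0 (-(b 1)) (-(b 2)) x := pair12_pole_rowPsi1_pos e₁ e₂ (-(b 1)) (-(b 2)) hx0 (by nlinarith) hF
    rw [h0]
    refine ⟨hF, ?_, ?_, ?_⟩
    · have h := pair12_rowPsi3_law e₁ e₂ (-(b 1)) (-(b 2)) hF
      rw [hs]; linarith [h]
    · rw [hs]; exact pair12_rowPsi2_sq e₁ e₂ (-(b 1)) (-(b 2)) hF
    · rw [eighthOrder_c2_mid p s, eighthOrder_c3_mid p s, eighthOrder_c4_mid p s]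
      exact eighthOrder_pole_mid_pos hp0 hps' hψ
  · -- (K02) fast knee, rate p + s
    refine ⟨p + s, Or.inr (Or.inr rfl), fun x hx => ?_⟩
    have hx0 := huv_pos x hx
    have hn1 : -(b 1) = 0 := by rw [h1, neg_zero]
    have hAC : b 0 * (-(b 2)) < 0 := by nlinarith
    have hψ := knee_rowPsi1_neg e₁ e₂ (b 0) (-(b 2)) hx0 hAC
    have hF : b 0 - (-(b 2)) * x ^ (e₁ + e₂ + 2) ≠ 0 := by
      intro h
      have hA : b 0 = -(b 2) * x ^ (e₁ + e₂ + 2) := by linarith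
      rw [hA] at hAC
      nlinarith [sq_nonneg (b 2), pow_pos hx0 (e₁ + e₂ + 2)]
    have hq := hring x hx
    rw [hn1] at hq ⊢
    refine ⟨by rwa [zero_mul, sub_zero], ?_, ?_, ?_⟩
    · have h := pair02_rowPsi3_law e₁ e₂ (b 0) (-(b 2)) x
      rw [hp, hs]
      have : ((e₁ : ℝ) + 1 + ((e₂ : ℝ) + 1)) = ((e₁ : ℝ) + e₂ + 2) := by ring
      rw [this]; linarith [h]
    · rw [hp, hs]
      have : ((e₁ : ℝ) + 1 + ((e₂ : ℝ) + 1)) = ((e₁ : ℝ) + e₂ + 2) := by ring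
      rw [this]; exact pair02_rowPsi2_sq e₁ e₂ (b 0) (-(b 2)) x
    · rw [eighthOrder_c2_fast p s, eighthOrder_c3_fast p s, eighthOrder_c4_fast p s]
      have hψne : rowPsi1 e₁ e₂ (b 0) 0 (-(b 2)) x ≠ 0 := hψ.ne
      rw [hp, hs] at hq ⊢
      exact (eighthOrder_knee_off_iff _ _ _ _ hψne).2 hq
  · -- (P02) pole, rate p + s
    refine ⟨p + s, Or.inr (Or.inr rfl), fun x hx => ?_⟩
    have hx0 := huv_pos x hx
    have hn1 : -(b 1) = 0 := by rw [h1, neg_zero]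
    have hb2 : b 2 ≠ 0 := by rintro h; rw [h, mul_zero] at hsgn; exact lt_irrefl _ hsgn
    have hend' : 0 ≤ (b 0 + b 2 * u ^ (e₁ + e₂ + 2)) * (b 0 + b 2 * v ^ (e₁ + e₂ + 2)) := by
      rw [h1] at hend; simpa using hend
    have hne : b 0 + b 2 * x ^ (e₁ + e₂ + 2) ≠ 0 :=
      binomial_ne_zero_of_endpoints (b 0) (b 2) (Nat.succ_ne_zero _) hu hx hend' hb2
    have hF : b 0 - (-(b 2)) * x ^ (e₁ + e₂ + 2) ≠ 0 := by
      have : b 0 - (-(b 2)) * x ^ (e₁ + e₂ + 2) = b 0 + b 2 * x ^ (e₁ + e₂ + 2) := by ring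
      rwa [this]
    have hψ : 0 < rowPsi1 e₁ e₂ (b 0) 0 (-(b 2)) x := pair02_pole_rowPsi1_pos e₁ e₂ (b 0) (-(b 2)) hx0 (by nlinarith) hF
    rw [hn1]
    refine ⟨by rwa [zero_mul, sub_zero], ?_, ?_, ?_⟩
    · have h := pair02_rowPsi3_law e₁ e₂ (b 0) (-(b 2)) x
      rw [hp, hs]
      have : ((e₁ : ℝ) + 1 + ((e₂ : ℝ) + 1)) = ((e₁ : ℝ) + e₂ + 2) := by ring
      rw [this]; linarith [h]
    · rw [hp, hs]
      have : ((e₁ : ℝ) + 1 + ((e₂ : ℝ) + 1)) = ((e₁ : ℝ) + e₂ + 2) := by ring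
      rw [this]; exact pair02_rowPsi2_sq e₁ e₂ (b 0) (-(b 2)) x
    · rw [eighthOrder_c2_fast p s, eighthOrder_c3_fast p s, eighthOrder_c4_fast p s]
      exact eighthOrder_pole_fast_pos hp0 hs0 hψ

end ProductPlusOne

end Summit.ValiantsHypothesis.ValiantsHypothesis.Theorems.LacunarySymmetroidMatrixDescartes
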